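import Mathlib.Data.Finset.Image
import Mathlib.Data.Finset.Powerset
import Mathlib.Data.Real.Basic
import Mathlib.Order.UpperLower.Basic
import Mathlib.Tactic.NormNum
import HarnessLib

/-!
# `NoHeavyLowerTail` (crux stmt-CriticalPhenomena-4575), Sahi programme P4: block events — reading configurations of a block
# `W : Finset ι` as subsets of the subtype `↥W` (definitions for the `ED` ↔ `prodBernoulli` bridge of `…SahiE3JuntaMeetSmall`)

Definitions file (cell `prim-l12`, seat P4, generation 3; `--supports stmt-CriticalPhenomena-4575`).  Two bookkeeping definitions
and their four basic properties; no mathematics.  They let the finitary weighted-cube calculus (`ED`, configurations `S ⊆ W` of an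
arbitrary index type `ι`) talk to the product measure `prodBernoulli` on `Set ↥W` (a `Fintype` of cardinality `|W|`), which is the
language of the Sahi cell's cube theorems `SahiC3Cube.sahiC3_of_card_le_three/_four`.

* `liftCfg W ω` — the configuration `{j ∈ W | ⟨j,_⟩ ∈ ω} ⊆ W` read off a set `ω : Set ↥W` of block coordinates (`liftCfg_mono`;
  `liftCfg_coe`: on `↑S`, `S : Finset ↥W`, it is `S.map (Embedding.subtype _)`).
* `blockEvent W φ = {ω | φ (liftCfg W ω) = 1}` — the event of a `{0,1}`-valued function of configurations (`isUpperSet_blockEvent`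
  for monotone `φ`; `blockEvent_inter`: intersections are block events of products).  [this work]
-/

noncomputable section

open Classical

namespace Summit.CriticalPhenomena.PercolationContinuityZ3.Theorems

namespace SahiE3JuntaMeet

variable {ι : Type*}

/-- Reading a set of block coordinates (`ω : Set ↥W`) as a configuration `⊆ W` of the ambient index type. [this work] -/
def liftCfg (W : Finset ι) (ω : Set ↥W) : Finset ι := W.filter fun j => ∃ h : j ∈ W, (⟨j, h⟩ : ↥W) ∈ ω

/-- `liftCfg` is monotone. [folklore] -/
theorem liftCfg_mono (W : Finset ι) {ω ω' : Set ↥W} (h : ω ⊆ ω') : liftCfg W ω ⊆ liftCfg W ω' := by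
  intro j hj
  simp only [liftCfg, Finset.mem_filter] at hj ⊢
  obtain ⟨hjW, hW, hω⟩ := hj
  exact ⟨hjW, hW, h hω⟩

/-- On a finite set of block coordinates `liftCfg` is the embedding into `ι`. [folklore] -/
theorem liftCfg_coe (W : Finset ι) (S : Finset ↥W) : liftCfg W ↑S = S.map (Function.Embedding.subtype _) := by
  ext j
  simp only [liftCfg, Finset.mem_filter, Finset.mem_coe, Finset.mem_map, Function.Embedding.coe_subtype]
  constructor
  · rintro ⟨_, hW, hS⟩
    exact ⟨⟨j, hW⟩, hS, rfl⟩
  · rintro ⟨⟨j', hj'⟩, hS, rfl⟩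
    exact ⟨hj', hj', hS⟩

/-- The event of block-coordinate sets on which a (`{0,1}`-valued) function of configurations equals `1`. [this work] -/
def blockEvent (W : Finset ι) (φ : Finset ι → ℝ) : Set (Set ↥W) := {ω | φ (liftCfg W ω) = 1}

/-- Unfolding `blockEvent`. [this work] -/
theorem mem_blockEvent (W : Finset ι) (φ : Finset ι → ℝ) (ω : Set ↥W) : ω ∈ blockEvent W φ ↔ φ (liftCfg W ω) = 1 :=
  Iff.rfl

/-- Block events of monotone `{0,1}`-valued functions are increasing. [folklore] -/
theorem isUpperSet_blockEvent (W : Finset ι) {φ : Finset ι → ℝ} (hφ : ∀ ⦃S T : Finset ι⦄, S ⊆ T → φ S ≤ φ T)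
    (hφ01 : ∀ S, φ S = 0 ∨ φ S = 1) : IsUpperSet (blockEvent W φ) := by
  intro ω ω' hle hω
  simp only [blockEvent, Set.mem_setOf_eq] at hω ⊢
  have h1 := hφ (liftCfg_mono W hle)
  rw [hω] at h1
  rcases hφ01 (liftCfg W ω') with h | h
  · rw [h] at h1; exact absurd h1 (by norm_num)
  · exact h

/-- Intersections of block events are block events of products (for `{0,1}`-valued functions). [folklore] -/
theorem blockEvent_inter (W : Finset ι) {φ ψ : Finset ι → ℝ} (hφ01 : ∀ S, φ S = 0 ∨ φ S = 1) (hψ01 : ∀ S, ψ S = 0 ∨ ψ S = 1) :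
    blockEvent W φ ∩ blockEvent W ψ = blockEvent W (fun S => φ S * ψ S) := by
  ext ω
  simp only [blockEvent, Set.mem_inter_iff, Set.mem_setOf_eq]
  rcases hφ01 (liftCfg W ω) with h | h <;> rcases hψ01 (liftCfg W ω) with h' | h' <;> norm_num [h, h']

end SahiE3JuntaMeet

end Summit.CriticalPhenomena.PercolationContinuityZ3.Theorems

end
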